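import Literature.RingTheory.FormalGroups.PadicLogTypeSeriesAdd
import HarnessLib

/-!
# Iterated addition: `Λ([k]_G y) = k · Λ(y)` for the `p`-adic log-type sums

Topic `Literature/RingTheory/FormalGroups`; namespace `Literature.RingTheory.FormalGroups.PadicLogSeries`. THEOREMS ONLY (no
definition, no named fact, no instance, no `sorry`). Corollary of the additivity file `PadicLogTypeSeriesAdd`
(`logSum_eq_add_of_forall_sub_aeval_mem'`): along an ITERATED-ADDITION TOWER `s 0 = 0`, `s (k+1)` a `p`-adic value of `G(s k, y)`,
one has ★★ `logSum_eq_nsmul_of_tower`: `Λ_N(s k) = k · Λ_N(y)`. With `k = p` this is the `[p]`-COMPATIBILITY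
`Λ([p]_G y) = p · Λ(y)` consumed by `PadicLogTypeSeriesDivision.frobenius_honda_eq_zero_of_tower` (brick B4 of the φ-road of line
`kato_lever`, crux K★ `stmt-BirchSwinnertonDyer-22226`, memo `Lines/kato-lever-K2-phi-road.md`); also `logSum_zero_zero`.
Infrastructure only: BSD / K★ are not proved by any of this.

## References
* J. H. Silverman, *The Arithmetic of Elliptic Curves* (2009), IV.2, IV.5.2. [SilvermanAEC2009]
* P. Colmez, *Périodes p-adiques des variétés abéliennes*, Math. Ann. 292 (1992), §2. [Colmez1992PeriodesAbeliennes]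
* M. Hazewinkel, *Formal Groups and Applications* (1978), Ch. I §2.1. [Hazewinkel1978]
-/

noncomputable section

open Finset

namespace Literature.RingTheory.FormalGroups

namespace PadicLogSeries

open Literature.AlgebraicGeometry.Resolution
open MvPowerSeries (truncTotal)

variable {p : ℕ} [hp : Fact p.Prime]

universe u

variable {B : Type u} [CommRing B] [IsDomain B] [CharZero B] (ι : ℤ_[p] →+* B) (b : ℕ → ℤ_[p])

/-! ## §6 Iterated addition: `Λ([k]_G y) = k · Λ(y)` -/

omit [IsDomain B] [CharZero B] in
/-- `Λ_N(0, 0) = 0` (`N ≥ 1`): every term `ι(b_m d) z^{m/N} 0^{m%N}` with `z = 0` vanishes. [cite: Hazewinkel1978, Ch. I §2.1] -/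
theorem logSum_zero_zero {N : ℕ} (hN : 1 ≤ N) : logSum ι b N (0 : B) 0 = 0 := by
  refine AdicCompletion.ext_evalₐ fun n => ?_
  rw [evalₐ_logSum ι b _ _ hN, map_zero]
  have : partialSum ι b N (0 : B) 0 (2 * n * N) = 0 := by
    refine Finset.sum_eq_zero fun m _ => ?_
    rw [term]
    rcases Nat.eq_zero_or_pos ((m + 1) / N) with hq | hq
    · have hr : (m + 1) % N ≠ 0 := by
        intro hr
        have := Nat.div_add_mod (m + 1) N
        rw [hq, hr, mul_zero, add_zero] at this
        exact Nat.succ_ne_zero m this.symm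
      rw [zero_pow hr, mul_zero]
    · rw [zero_pow (Nat.pos_iff_ne_zero.1 hq), mul_zero, zero_mul]
  rw [this, map_zero]

/-- ★★ **`Λ([k]_G y) = k · Λ(y)`.** Let `f`, `G` be as in `logSum_eq_add_of_forall_sub_aeval_mem'` and let `s : ℕ → B` be an
ITERATED-ADDITION TOWER over a `p`-nilpotent `y` (`y^N = p z`): `s 0 = 0`, each `s k` is `p`-nilpotent of index `N` (witness `zs k`), and
`s (k+1)` is a `p`-adic value of `G(s k, y)`. Then **`Λ_N(s k) = k · Λ_N(y)`** for every `k` — in particular `Λ([p]_G y) = p · Λ(y)` for the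
canonical `p`-adic values of a formal group law in `𝔸_inf`, the `[p]`-compatibility consumed by `PadicLogTypeSeriesDivision`.
[cite: SilvermanAEC2009, IV.2, IV.5.2] [cite: Colmez1992PeriodesAbeliennes, §2] -/
theorem logSum_eq_nsmul_of_tower (f : PowerSeries ℚ)
    (hbf : ∀ m : ℕ, algebraMap B (FractionRing B) (ι (b m)) =
      (m : FractionRing B) * algebraMap ℚ (FractionRing B) (PowerSeries.coeff m f))
    {G : MvPowerSeries (Fin 2) ℤ} (hG0 : MvPowerSeries.constantCoeff G = 0)
    (hfG : f.subst (MvPowerSeries.map (Int.castRingHom ℚ) G) =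
      f.subst (MvPowerSeries.X 0 : MvPowerSeries (Fin 2) ℚ) + f.subst (MvPowerSeries.X 1 : MvPowerSeries (Fin 2) ℚ))
    {N : ℕ} (hN : 1 ≤ N) {y z : B} (hyz : y ^ N = (p : B) * z) (s zs : ℕ → B) (hs0 : s 0 = 0)
    (hszs : ∀ k, s k ^ N = (p : B) * zs k)
    (hstep : ∀ k j : ℕ, ∃ D₀ : ℕ, ∀ D, D₀ ≤ D →
      s (k + 1) - MvPolynomial.aeval (![s k, y] : Fin 2 → B) (truncTotal (D + 1) G) ∈ Ideal.span {(p : B)} ^ j)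
    (k : ℕ) : logSum ι b N (s k) (zs k) = (k : AdicCompletion (Ideal.span {(p : B)}) B) * logSum ι b N y z := by
  induction k with
  | zero =>
    have hz0 : zs 0 = 0 := by
      have h := hszs 0
      rw [hs0, zero_pow (by omega)] at h
      exact (mul_eq_zero.1 h.symm).resolve_left (Nat.cast_ne_zero.2 hp.out.ne_zero)
    rw [hs0, hz0, logSum_zero_zero ι b hN, Nat.cast_zero, zero_mul]
  | succ k ih =>
    have hyz' : ∀ i : Fin 2, (![s k, y] : Fin 2 → B) i ^ N = (p : B) * (![zs k, z] : Fin 2 → B) i := by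
      intro i; fin_cases i
      · exact hszs k
      · exact hyz
    have h := logSum_eq_add_of_forall_sub_aeval_mem' ι b f hbf hG0 hfG hN hyz' (hstep k) (hszs (k + 1))
    simp only [Matrix.cons_val_zero, Matrix.cons_val_one] at h
    rw [h, ih, Nat.cast_succ]
    ring

end PadicLogSeries

end Literature.RingTheory.FormalGroups

end
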